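import Summits.AtomisticToContinuum.HydrodynamicLimit.Theorems.AntiMazurCoboundariesCellForecastPressureDecayContactStatisticsTail
import HarnessLib

/-!
# S2c(I) · summing the two-marked expansion: the geometric series of the weak isotropy bound
# (piece of stub `stub_contactStatistics`, crux line `enskog-compensator-martingale`,
# crux `CellForecastPressureDecay`, stmt-AtomisticToContinuum-13915)

The purely combinatorial step of the weak isotropy of the pair law of the cell. The difference
`E ψ(xᵢ − xⱼ) − E ψ(g(xᵢ − xⱼ))` times `Ξ(univ)` is the two-marked expansion (`…Expansion`)
`∑_{B ∋ i,j} I₁(B) Ξ(univ∖B) + ∑_{B ∋ i, B ∌ j} ∑_{B' ∋ j ⊆ univ∖B} I₂(B,B') Ξ((univ∖B)∖B')`, whose brackets are bounded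
(`…Layer`, from `…Bulk` and `…Brackets`) by `(6·#B·σ/L)·s·t(#B)p^{#B−2}` and
`(6((#B+#B')σ + σ + 3)/L)·s·t(#B)p^{#B−1}t(#B')p^{#B'−1}` (`s = 2L⁻³∫|ψ|`, `p` the mass of one excluded ball), and
whose ratios satisfy `Ξ(univ∖B) ≤ a^{#B} Ξ(univ)` (`…Tail`, `a = (1 − np)⁻¹`). This file sums the series
(`abs_clusterSum_le`): if `2e(2ap)n ≤ 1` the total is at most `Ξ(univ) · (6s/L)(2σ + 3)(2a)²e²` — polynomial
factors `#B`, `#B + #B' + 1` are absorbed into `2^{#B}`, and the one- and two-root tree sums of `…Tail` are `≤ e, e²`.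

References: E. Pulvirenti, D. Tsagkarogiannis, Comm. Math. Phys. 316 (2012) 289–306, §4 (convergence of the
canonical cluster expansion); S. Friedli, Y. Velenik, *Statistical Mechanics of Lattice Systems* (2017), §5.4.
-/

noncomputable section

open MeasureTheory ProbabilityTheory Set Filter Finset
open scoped ENNReal BigOperators
open Literature.Analysis.FluidPDE Literature.MathematicalPhysics.KineticTheory
open Literature.MathematicalPhysics.StatisticalMechanics
open Literature.Probability.LatticeModels (treeNumber)

namespace Summit.AtomisticToContinuum.HydrodynamicLimit.Theorems.EnskogCompensator

/-! ## § 1 Absorbing polynomial factors -/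

/-- `k a^k ≤ (2a)^k` for `a ≥ 0`. [folklore] -/
theorem card_mul_pow_le_two_mul_pow {a : ℝ} (ha : 0 ≤ a) (k : ℕ) : (k : ℝ) * a ^ k ≤ (2 * a) ^ k := by
  rw [mul_pow]
  have h : (k : ℝ) ≤ 2 ^ k := by exact_mod_cast (Nat.lt_two_pow_self (n := k)).le
  exact mul_le_mul_of_nonneg_right h (pow_nonneg ha k)

/-- `(k + 1) a^k ≤ (2a)^k` for `a ≥ 0`. [folklore] -/
theorem succ_mul_pow_le_two_mul_pow {a : ℝ} (ha : 0 ≤ a) (k : ℕ) : ((k : ℝ) + 1) * a ^ k ≤ (2 * a) ^ k := by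
  rw [mul_pow]
  have h : (k : ℝ) + 1 ≤ 2 ^ k := by exact_mod_cast (Nat.lt_two_pow_self (n := k))
  exact mul_le_mul_of_nonneg_right h (pow_nonneg ha k)

/-! ## § 2 The sum of the two-marked expansion -/

/-- **Summing the two-marked expansion.** Labels `Fin n`, `i ≠ j`; nonnegative "partition functions" `Ξ` with the
ratio bound `Ξ(univ ∖ B) ≤ a^{#B} Ξ(univ)`; brackets `I₁(B)` (`B ∋ i, j`) and `I₂(B,B')` (`B ∋ i`, `B ∌ j`,
`B' ∋ j`, `B' ⊆ univ ∖ B`) bounded by `(6 #B σ/L) s t(#B) p^{#B−2}` and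
`(6((#B + #B')σ + σ + 3)/L) s t(#B) p^{#B−1} t(#B') p^{#B'−1}`. If `2 e (2ap) n ≤ 1` then
`|∑ I₁ Ξ(univ∖B) + ∑∑ I₂ Ξ((univ∖B)∖B')| ≤ Ξ(univ) · (6 s/L)(2σ + 3)(2a)²e²`. [cite: PulvirentiTsagkarogiannis2012, §4] -/
theorem abs_clusterSum_le {n : ℕ} {i j : Fin n} (hij : i ≠ j) {σ L s p a : ℝ} (hσ : 0 ≤ σ) (hL : 0 < L)
    (hs : 0 ≤ s) (hp : 0 ≤ p) (ha : 0 ≤ a) (hcond : 2 * Real.exp 1 * (2 * a * p) * n ≤ 1)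
    (Ξ : Finset (Fin n) → ℝ) (hΞ : ∀ W, 0 ≤ Ξ W)
    (hratio : ∀ B : Finset (Fin n), Ξ (Finset.univ \ B) ≤ a ^ B.card * Ξ Finset.univ)
    (I₁ : Finset (Fin n) → ℝ) (I₂ : Finset (Fin n) → Finset (Fin n) → ℝ)
    (h₁ : ∀ B ∈ ((Finset.univ : Finset (Fin n)).powerset.filter (fun B => i ∈ B)).filter (fun B => j ∈ B),
      |I₁ B| ≤ 6 * (B.card * σ) / L * s * (treeNumber B.card * p ^ (B.card - 2)))
    (h₂ : ∀ B ∈ ((Finset.univ : Finset (Fin n)).powerset.filter (fun B => i ∈ B)).filter (fun B => j ∉ B),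
      ∀ B' ∈ (Finset.univ \ B).powerset.filter (fun B' => j ∈ B'),
        |I₂ B B'| ≤ 6 * ((B.card + B'.card) * σ + (σ + 3)) / L * s *
          ((treeNumber B.card * p ^ (B.card - 1)) * (treeNumber B'.card * p ^ (B'.card - 1)))) :
    |(∑ B ∈ ((Finset.univ : Finset (Fin n)).powerset.filter (fun B => i ∈ B)).filter (fun B => j ∈ B),
        I₁ B * Ξ (Finset.univ \ B)) +
      ∑ B ∈ ((Finset.univ : Finset (Fin n)).powerset.filter (fun B => i ∈ B)).filter (fun B => j ∉ B),
        ∑ B' ∈ (Finset.univ \ B).powerset.filter (fun B' => j ∈ B'),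
          I₂ B B' * Ξ ((Finset.univ \ B) \ B')| ≤
      Ξ Finset.univ * (6 * s / L * (2 * σ + 3) * (2 * a) ^ 2 * (Real.exp 1 * Real.exp 1)) := by
  set F1 := ((Finset.univ : Finset (Fin n)).powerset.filter (fun B => i ∈ B)).filter (fun B => j ∈ B) with hF1
  set F2 := ((Finset.univ : Finset (Fin n)).powerset.filter (fun B => i ∈ B)).filter (fun B => j ∉ B) with hF2
  set x : ℝ := 2 * a * p with hx
  have hx0 : 0 ≤ x := by positivity
  have he : 0 ≤ Real.exp 1 := (Real.exp_pos 1).le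
  have hΞu := hΞ Finset.univ
  have hcard : ((Finset.univ : Finset (Fin n)).card : ℝ) = n := by simp
  -- the one- and two-root tree sums
  have hTS2 : ∑ B ∈ F1, (treeNumber B.card : ℝ) * x ^ (B.card - 2) ≤ Real.exp 1 * Real.exp 1 :=
    sum_filter_mem_mem_treeNumber_mul_pow_le hx0 _ (Finset.mem_univ i) hij (by rw [hcard]; exact hcond)
  have hTS1 : ∀ W : Finset (Fin n), ∀ k ∈ W,
      ∑ B ∈ W.powerset.filter (fun B => k ∈ B), (treeNumber B.card : ℝ) * x ^ (B.card - 1) ≤ Real.exp 1 := by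
    intro W k hk
    rw [sum_filter_mem_treeNumber_mul_pow_pred x W hk]
    refine Literature.Probability.LatticeModels.treeSum_le_exp_one hx0 _ ?_
    have hc : ((W.erase k).card : ℝ) ≤ n := by
      have := (Finset.card_le_card (Finset.erase_subset k W)).trans (Finset.card_le_univ W)
      rw [Fintype.card_fin] at this
      exact_mod_cast this
    nlinarith [mul_nonneg he hx0]
  -- type 1 terms
  have hterm1 : ∀ B ∈ F1, |I₁ B * Ξ (Finset.univ \ B)| ≤
      Ξ Finset.univ * (6 * σ / L * s * (2 * a) ^ 2) * (treeNumber B.card * x ^ (B.card - 2)) := by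
    intro B hB
    have hB' := hB
    simp only [hF1, Finset.mem_filter, Finset.mem_powerset] at hB'
    obtain ⟨⟨-, hiB⟩, hjB⟩ := hB'
    have hk2 : 2 ≤ B.card := by
      have : ({i, j} : Finset (Fin n)) ⊆ B := by
        intro c hc; simp only [Finset.mem_insert, Finset.mem_singleton] at hc
        rcases hc with rfl | rfl <;> assumption
      have := Finset.card_le_card this
      rwa [Finset.card_pair hij] at this
    rw [abs_mul, abs_of_nonneg (hΞ _)]
    have hpoly : (B.card : ℝ) * a ^ B.card ≤ (2 * a) ^ 2 * (2 * a) ^ (B.card - 2) := by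
      rw [← pow_add, Nat.add_sub_cancel' hk2]
      exact card_mul_pow_le_two_mul_pow ha _
    have hxpow : x ^ (B.card - 2) = (2 * a) ^ (B.card - 2) * p ^ (B.card - 2) := by rw [hx, mul_pow]
    calc |I₁ B| * Ξ (Finset.univ \ B)
        ≤ (6 * (B.card * σ) / L * s * (treeNumber B.card * p ^ (B.card - 2))) * (a ^ B.card * Ξ Finset.univ) :=
          mul_le_mul (h₁ B hB) (hratio B) (hΞ _) (by positivity)
      _ = Ξ Finset.univ * (6 * σ / L * s) * (treeNumber B.card * p ^ (B.card - 2)) * ((B.card : ℝ) * a ^ B.card) := by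
          ring
      _ ≤ Ξ Finset.univ * (6 * σ / L * s) * (treeNumber B.card * p ^ (B.card - 2)) *
            ((2 * a) ^ 2 * (2 * a) ^ (B.card - 2)) :=
          mul_le_mul_of_nonneg_left hpoly (by positivity)
      _ = Ξ Finset.univ * (6 * σ / L * s * (2 * a) ^ 2) * (treeNumber B.card * x ^ (B.card - 2)) := by
          rw [hxpow]; ring
  -- type 2 terms
  have hterm2 : ∀ B ∈ F2, ∀ B' ∈ (Finset.univ \ B).powerset.filter (fun B' => j ∈ B'),
      |I₂ B B' * Ξ ((Finset.univ \ B) \ B')| ≤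
        Ξ Finset.univ * (6 * (σ + 3) / L * s * (2 * a) ^ 2) *
          ((treeNumber B.card * x ^ (B.card - 1)) * (treeNumber B'.card * x ^ (B'.card - 1))) := by
    intro B hB B' hB'
    have hBm := hB
    have hB'm := hB'
    simp only [hF2, Finset.mem_filter, Finset.mem_powerset] at hBm hB'm
    obtain ⟨⟨-, hiB⟩, hjB⟩ := hBm
    obtain ⟨hB'W, hjB'⟩ := hB'm
    have hk1 : 1 ≤ B.card := Finset.card_pos.2 ⟨i, hiB⟩
    have hk1' : 1 ≤ B'.card := Finset.card_pos.2 ⟨j, hjB'⟩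
    have hdisj : Disjoint B B' := Finset.disjoint_of_subset_right hB'W Finset.disjoint_sdiff
    have hsd : (Finset.univ \ B) \ B' = Finset.univ \ (B ∪ B') := sdiff_sdiff_left
    have hrat : Ξ ((Finset.univ \ B) \ B') ≤ a ^ (B.card + B'.card) * Ξ Finset.univ := by
      rw [hsd, ← Finset.card_union_of_disjoint hdisj]
      exact hratio _
    rw [abs_mul, abs_of_nonneg (hΞ _)]
    have hD : (B.card + B'.card) * σ + (σ + 3) ≤ (σ + 3) * ((B.card + B'.card : ℕ) + 1) := by
      push_cast
      nlinarith [mul_nonneg (by positivity : (0 : ℝ) ≤ B.card + B'.card) (by norm_num : (0 : ℝ) ≤ 3)]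
    have hpoly : (((B.card + B'.card : ℕ) : ℝ) + 1) * a ^ (B.card + B'.card) ≤
        (2 * a) ^ 2 * ((2 * a) ^ (B.card - 1) * (2 * a) ^ (B'.card - 1)) := by
      rw [← pow_add, ← pow_add, show 2 + (B.card - 1 + (B'.card - 1)) = B.card + B'.card by omega]
      exact succ_mul_pow_le_two_mul_pow ha _
    have hxpow : x ^ (B.card - 1) * x ^ (B'.card - 1) =
        ((2 * a) ^ (B.card - 1) * (2 * a) ^ (B'.card - 1)) * (p ^ (B.card - 1) * p ^ (B'.card - 1)) := by
      rw [hx, mul_pow, mul_pow]; ring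
    have hT0 : 0 ≤ (treeNumber B.card * p ^ (B.card - 1)) * (treeNumber B'.card * p ^ (B'.card - 1)) := by positivity
    calc |I₂ B B'| * Ξ ((Finset.univ \ B) \ B')
        ≤ (6 * ((B.card + B'.card) * σ + (σ + 3)) / L * s *
            ((treeNumber B.card * p ^ (B.card - 1)) * (treeNumber B'.card * p ^ (B'.card - 1)))) *
            (a ^ (B.card + B'.card) * Ξ Finset.univ) :=
          mul_le_mul (h₂ B hB B' hB') hrat (hΞ _) (by positivity)
      _ ≤ (6 * ((σ + 3) * ((B.card + B'.card : ℕ) + 1)) / L * s *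
            ((treeNumber B.card * p ^ (B.card - 1)) * (treeNumber B'.card * p ^ (B'.card - 1)))) *
            (a ^ (B.card + B'.card) * Ξ Finset.univ) := by
          gcongr
      _ = Ξ Finset.univ * (6 * (σ + 3) / L * s) *
            ((treeNumber B.card * p ^ (B.card - 1)) * (treeNumber B'.card * p ^ (B'.card - 1))) *
            ((((B.card + B'.card : ℕ) : ℝ) + 1) * a ^ (B.card + B'.card)) := by ring
      _ ≤ Ξ Finset.univ * (6 * (σ + 3) / L * s) *
            ((treeNumber B.card * p ^ (B.card - 1)) * (treeNumber B'.card * p ^ (B'.card - 1))) *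
            ((2 * a) ^ 2 * ((2 * a) ^ (B.card - 1) * (2 * a) ^ (B'.card - 1))) :=
          mul_le_mul_of_nonneg_left hpoly (by positivity)
      _ = Ξ Finset.univ * (6 * (σ + 3) / L * s * (2 * a) ^ 2) *
            ((treeNumber B.card * x ^ (B.card - 1)) * (treeNumber B'.card * x ^ (B'.card - 1))) := by
          rw [show (treeNumber B.card : ℝ) * x ^ (B.card - 1) * (treeNumber B'.card * x ^ (B'.card - 1)) =
            (treeNumber B.card * treeNumber B'.card) * (x ^ (B.card - 1) * x ^ (B'.card - 1)) by ring, hxpow]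
          ring
  -- sum the type 1 terms
  have hS1 : |∑ B ∈ F1, I₁ B * Ξ (Finset.univ \ B)| ≤
      Ξ Finset.univ * (6 * σ / L * s * (2 * a) ^ 2) * (Real.exp 1 * Real.exp 1) := by
    refine (Finset.abs_sum_le_sum_abs _ _).trans ((Finset.sum_le_sum hterm1).trans ?_)
    rw [← Finset.mul_sum]
    exact mul_le_mul_of_nonneg_left hTS2 (by positivity)
  -- sum the type 2 terms
  have hS2 : |∑ B ∈ F2, ∑ B' ∈ (Finset.univ \ B).powerset.filter (fun B' => j ∈ B'),
      I₂ B B' * Ξ ((Finset.univ \ B) \ B')| ≤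
        Ξ Finset.univ * (6 * (σ + 3) / L * s * (2 * a) ^ 2) * (Real.exp 1 * Real.exp 1) := by
    refine (Finset.abs_sum_le_sum_abs _ _).trans ?_
    have hinner : ∀ B ∈ F2, |∑ B' ∈ (Finset.univ \ B).powerset.filter (fun B' => j ∈ B'),
        I₂ B B' * Ξ ((Finset.univ \ B) \ B')| ≤
          Ξ Finset.univ * (6 * (σ + 3) / L * s * (2 * a) ^ 2) *
            ((treeNumber B.card * x ^ (B.card - 1)) * Real.exp 1) := by
      intro B hB
      have hBm := hB
      simp only [hF2, Finset.mem_filter, Finset.mem_powerset] at hBm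
      have hjW : j ∈ Finset.univ \ B := Finset.mem_sdiff.2 ⟨Finset.mem_univ j, hBm.2⟩
      refine (Finset.abs_sum_le_sum_abs _ _).trans ((Finset.sum_le_sum (hterm2 B hB)).trans ?_)
      rw [← Finset.mul_sum, ← Finset.mul_sum]
      refine mul_le_mul_of_nonneg_left (mul_le_mul_of_nonneg_left (hTS1 _ j hjW) (by positivity)) (by positivity)
    refine (Finset.sum_le_sum hinner).trans ?_
    have hF2sub : F2 ⊆ (Finset.univ : Finset (Fin n)).powerset.filter (fun B => i ∈ B) := Finset.filter_subset _ _
    calc ∑ B ∈ F2, Ξ Finset.univ * (6 * (σ + 3) / L * s * (2 * a) ^ 2) *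
          ((treeNumber B.card * x ^ (B.card - 1)) * Real.exp 1)
        = Ξ Finset.univ * (6 * (σ + 3) / L * s * (2 * a) ^ 2) * Real.exp 1 *
            ∑ B ∈ F2, (treeNumber B.card : ℝ) * x ^ (B.card - 1) := by
          rw [Finset.mul_sum]; exact Finset.sum_congr rfl fun B _ => by ring
      _ ≤ Ξ Finset.univ * (6 * (σ + 3) / L * s * (2 * a) ^ 2) * Real.exp 1 *
            ∑ B ∈ (Finset.univ : Finset (Fin n)).powerset.filter (fun B => i ∈ B),
              (treeNumber B.card : ℝ) * x ^ (B.card - 1) :=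
          mul_le_mul_of_nonneg_left (Finset.sum_le_sum_of_subset_of_nonneg hF2sub fun B _ _ => by positivity)
            (by positivity)
      _ ≤ Ξ Finset.univ * (6 * (σ + 3) / L * s * (2 * a) ^ 2) * Real.exp 1 * Real.exp 1 :=
          mul_le_mul_of_nonneg_left (hTS1 _ i (Finset.mem_univ i)) (by positivity)
      _ = _ := by ring
  calc |(∑ B ∈ F1, I₁ B * Ξ (Finset.univ \ B)) +
        ∑ B ∈ F2, ∑ B' ∈ (Finset.univ \ B).powerset.filter (fun B' => j ∈ B'), I₂ B B' * Ξ ((Finset.univ \ B) \ B')|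
      ≤ |∑ B ∈ F1, I₁ B * Ξ (Finset.univ \ B)| +
          |∑ B ∈ F2, ∑ B' ∈ (Finset.univ \ B).powerset.filter (fun B' => j ∈ B'),
            I₂ B B' * Ξ ((Finset.univ \ B) \ B')| := abs_add_le _ _
    _ ≤ _ := add_le_add hS1 hS2
    _ = Ξ Finset.univ * (6 * s / L * (2 * σ + 3) * (2 * a) ^ 2 * (Real.exp 1 * Real.exp 1)) := by ring

/-! ## § 3 The registered sub-goal -/

/-- **Registered sub-goal `stub_contactStatistics_sum`** (piece of stub `stub_contactStatistics`, S2c, of the line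
`enskog-compensator-martingale`): the geometric series of the weak isotropy bound — with the ratio bound
`Ξ(univ ∖ B) ≤ a^{#B} Ξ(univ)`, the bracket bounds of the two-marked expansion and `2e(2ap)n ≤ 1`, the whole expansion
is at most `Ξ(univ) · (6s/L)(2σ + 3)(2a)²e²`. [cite: PulvirentiTsagkarogiannis2012, §4] -/
theorem stub_contactStatistics_sum : ∀ (n : ℕ) (i j : Fin n), i ≠ j → ∀ (σ L s p a : ℝ), 0 ≤ σ → 0 < L → 0 ≤ s →
    0 ≤ p → 0 ≤ a → 2 * Real.exp 1 * (2 * a * p) * n ≤ 1 → ∀ (Ξ : Finset (Fin n) → ℝ), (∀ W, 0 ≤ Ξ W) →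
    (∀ B : Finset (Fin n), Ξ (Finset.univ \ B) ≤ a ^ B.card * Ξ Finset.univ) →
    ∀ (I₁ : Finset (Fin n) → ℝ) (I₂ : Finset (Fin n) → Finset (Fin n) → ℝ),
    (∀ B ∈ ((Finset.univ : Finset (Fin n)).powerset.filter (fun B => i ∈ B)).filter (fun B => j ∈ B),
      |I₁ B| ≤ 6 * (B.card * σ) / L * s * (treeNumber B.card * p ^ (B.card - 2))) →
    (∀ B ∈ ((Finset.univ : Finset (Fin n)).powerset.filter (fun B => i ∈ B)).filter (fun B => j ∉ B),
      ∀ B' ∈ (Finset.univ \ B).powerset.filter (fun B' => j ∈ B'),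
        |I₂ B B'| ≤ 6 * ((B.card + B'.card) * σ + (σ + 3)) / L * s *
          ((treeNumber B.card * p ^ (B.card - 1)) * (treeNumber B'.card * p ^ (B'.card - 1)))) →
    |(∑ B ∈ ((Finset.univ : Finset (Fin n)).powerset.filter (fun B => i ∈ B)).filter (fun B => j ∈ B),
        I₁ B * Ξ (Finset.univ \ B)) +
      ∑ B ∈ ((Finset.univ : Finset (Fin n)).powerset.filter (fun B => i ∈ B)).filter (fun B => j ∉ B),
        ∑ B' ∈ (Finset.univ \ B).powerset.filter (fun B' => j ∈ B'),
          I₂ B B' * Ξ ((Finset.univ \ B) \ B')| ≤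
      Ξ Finset.univ * (6 * s / L * (2 * σ + 3) * (2 * a) ^ 2 * (Real.exp 1 * Real.exp 1)) :=
  fun _ _ _ hij _ _ _ _ _ hσ hL hs hp ha hcond Ξ hΞ hratio I₁ I₂ h₁ h₂ =>
    abs_clusterSum_le hij hσ hL hs hp ha hcond Ξ hΞ hratio I₁ I₂ h₁ h₂

end Summit.AtomisticToContinuum.HydrodynamicLimit.Theorems.EnskogCompensator

end
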